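import Mathlib.Combinatorics.SetFamily.FourFunctions
import Mathlib.Tactic
import HarnessLib
import HarnessLib.Audit.Tags
import Summits.CriticalPhenomena.PercolationContinuityZ3.Theorems.PercNearOneGluingNoHeavyLowerTailSahiPartitionDaykinCredit

/-!
# The rainbow lemma: the unconditional half bound via Daykin's inequality

Support file (seat `prim-masterthm-p1`, gen 34; `--supports stmt-CriticalPhenomena-4575`).  Pure theorems over `…SahiPartitionDaykin` (`rainbowMeets`);
no `sorry`, standard axioms.  Memo `run/shared/lean/prim/prim-masterthm/FROM-prim-masterthm-p1-g34-ISOLATED-AND-ANTICHAINS.md`.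

For ANY two disjoint subfamilies `S, T ⊆ P` the cross meets `S ⊼ T` are rainbow meets of `P` and the complements of the cross joins `S ⊻ T` are rainbow meets of `P`
(members of `S` and `T` are distinct members of `P`), so Daykin's inequality `#S · #T ≤ #(S ⊼ T) · #(S ⊻ T)` (Mathlib `Finset.le_card_infs_mul_card_sups`) gives
**`#S · #T ≤ (#rainbowMeets F P)²`** (`card_mul_card_le_card_rainbowMeets_sq`); with a balanced bipartition this is the unconditional **HALF RAINBOW BOUND
`#P ≤ 2 · #rainbowMeets F P`** (`card_le_two_mul_card_rainbowMeets`) for every family of subsets of `F` — no complement-freeness is needed for this half.  The rainbow lemma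
`RainbowMeetCojoin` (`#P ≤ #rainbowMeets`, complement-free) remains OPEN; this file records the product-inequality baseline that any proof must double. [this work]
-/

namespace Summit.CriticalPhenomena.PercolationContinuityZ3.Theorems.SahiColouredDaykin

open Finset
open scoped FinsetFamily

variable {α : Type*} [DecidableEq α]

/-- Cross meets of two disjoint subfamilies are rainbow meets. [this work] -/
theorem infs_subset_rainbowMeets {F : Finset α} {P S T : Finset (Finset α)} (hS : S ⊆ P) (hT : T ⊆ P) (hST : Disjoint S T) :
    S ⊼ T ⊆ rainbowMeets F P := by
  intro Z hZ
  rw [Finset.mem_infs] at hZ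
  obtain ⟨a, ha, b, hb, rfl⟩ := hZ
  have hab : a ≠ b := fun h => disjoint_left.1 hST ha (h ▸ hb)
  exact inter_mem_rainbowMeets (hS ha) (hT hb) hab

/-- Complements of cross joins of two disjoint subfamilies are rainbow meets, and complementation is injective on them: `#(S ⊻ T) ≤ #rainbowMeets`. [this work] -/
theorem card_sups_le_card_rainbowMeets {F : Finset α} {P S T : Finset (Finset α)} (hPF : ∀ X ∈ P, X ⊆ F)
    (hS : S ⊆ P) (hT : T ⊆ P) (hST : Disjoint S T) :
    #(S ⊻ T) ≤ #(rainbowMeets F P) := by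
  have hsub : ∀ W ∈ S ⊻ T, W ⊆ F := by
    intro W hW
    rw [Finset.mem_sups] at hW
    obtain ⟨a, ha, b, hb, rfl⟩ := hW
    exact union_subset (hPF a (hS ha)) (hPF b (hT hb))
  have hinj : Set.InjOn (fun W => F \ W) ((S ⊻ T : Finset (Finset α)) : Set (Finset α)) := by
    intro W hW W' hW' h
    simp only [mem_coe] at hW hW'
    have e1 : F \ (F \ W) = W := Finset.sdiff_sdiff_eq_self (hsub W hW)
    have e2 : F \ (F \ W') = W' := Finset.sdiff_sdiff_eq_self (hsub W' hW')
    have : F \ (F \ W) = F \ (F \ W') := by simp only [h]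
    rwa [e1, e2] at this
  rw [← card_image_of_injOn hinj]
  apply card_le_card
  intro Z hZ
  obtain ⟨W, hW, rfl⟩ := mem_image.1 hZ
  rw [Finset.mem_sups] at hW
  obtain ⟨a, ha, b, hb, rfl⟩ := hW
  have hab : a ≠ b := fun h => disjoint_left.1 hST ha (h ▸ hb)
  exact sdiff_union_mem_rainbowMeets (hS ha) (hT hb) hab

/-- **Daykin's inequality for rainbow meets.**  For disjoint subfamilies `S, T ⊆ P ⊆ 2^F`: `#S · #T ≤ (#rainbowMeets F P)²`. [this work] -/
theorem card_mul_card_le_card_rainbowMeets_sq (F : Finset α) (P S T : Finset (Finset α)) (hPF : ∀ X ∈ P, X ⊆ F)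
    (hS : S ⊆ P) (hT : T ⊆ P) (hST : Disjoint S T) :
    #S * #T ≤ #(rainbowMeets F P) * #(rainbowMeets F P) := by
  calc #S * #T ≤ #(S ⊼ T) * #(S ⊻ T) := Finset.le_card_infs_mul_card_sups S T
    _ ≤ #(rainbowMeets F P) * #(rainbowMeets F P) :=
        Nat.mul_le_mul (card_le_card (infs_subset_rainbowMeets hS hT hST)) (card_sups_le_card_rainbowMeets hPF hS hT hST)

/-- **HALF RAINBOW BOUND (unconditional).**  Every family `P` of subsets of `F` has `#P ≤ 2 · #rainbowMeets F P`. [this work] -/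
theorem card_le_two_mul_card_rainbowMeets (F : Finset α) (P : Finset (Finset α)) (hPF : ∀ X ∈ P, X ⊆ F) :
    #P ≤ 2 * #(rainbowMeets F P) := by
  -- a balanced bipartition `S ⊔ (P \ S)`
  obtain ⟨S, hSP, hS⟩ := Finset.exists_subset_card_eq (show #P / 2 ≤ #P from Nat.div_le_self _ _)
  have hT : #(P \ S) = #P - #P / 2 := by rw [card_sdiff_of_subset hSP, hS]
  have h := card_mul_card_le_card_rainbowMeets_sq F P S (P \ S) hPF hSP sdiff_subset disjoint_sdiff
  rw [hS, hT] at h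
  set m := #(rainbowMeets F P) with hm
  have hm1 : 1 ≤ m := card_pos.2 ⟨∅, mem_rainbowMeets_iff.2 (Or.inl rfl)⟩
  -- if `#P > 2m` then `(#P/2) (#P - #P/2) ≥ m (m+1) > m²`
  by_contra hcon
  push Not at hcon
  have h1 : m ≤ #P / 2 := by omega
  have h2 : m + 1 ≤ #P - #P / 2 := by omega
  have : m * (m + 1) ≤ #P / 2 * (#P - #P / 2) := Nat.mul_le_mul h1 h2
  nlinarith

end Summit.CriticalPhenomena.PercolationContinuityZ3.Theorems.SahiColouredDaykin
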